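import Mathlib.Combinatorics.SetFamily.FourFunctions
import Mathlib.Combinatorics.SimpleGraph.Basic
import Mathlib.Order.UpperLower.Basic
import HarnessLib

/-!
# The `x → ∞` corner of the two-cluster law: the uniform measure on MINIMUM `a–c` cuts is positively associated
# (min cuts form a sublattice of the Boolean lattice ⇒ Daykin / Ahlswede–Daykin)

Support file (`--supports stmt-CriticalPhenomena-4575`), FK sub-lane `prim-bschramm-fk-1` (gen 13) of the post-continuity programme;
builds on p205010 (kernel theorem, internal audit signed; external expert review pending).  Elementary combinatorics (two definitions,
no named facts, no sorries, standard axioms); recorded because it is one of the two solvable CORNERS of the node `FK.TwoClusterAssocPos`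
(`…AllQTwoClusterAssoc.lean`): with all edge activities `x_e = x → ∞` the two-cluster law `ν(S) ∝ C_S(x)·C_{V∖S}(x) ∼ x^{|E| − |∂S|}`
(on vertex sets `S ∋ a`, `∌ c` with `G[S]`, `G[V∖S]` connected) converges to the UNIFORM measure on the minimum `a–c` cuts, and that
measure is positively associated — by a two-line argument formalised here: the edge-boundary size is submodular
(`cutSize_union_add_inter_le`, Korte–Vygen Lemma 2.1(c)), so minimum `a–c` cuts are closed under `∪` and `∩` (`isMinCut_union`,
`isMinCut_inter`, Korte–Vygen Ch. 8 Ex. 1), i.e. they form a sublattice of the (distributive) lattice `Finset V`, and Daykin's inequality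
`|s|·|t| ≤ |s ⊼ t|·|s ⊻ t|` (Mathlib `Finset.le_card_infs_mul_card_sups`, a case of the four functions theorem) gives
**`minCuts_posAssoc`**: `#{min cuts in 𝒰}·#{min cuts in 𝒱} ≤ #{min cuts in 𝒰 ∩ 𝒱}·#{min cuts}` for up-sets `𝒰, 𝒱` of vertex sets.
(The other solvable corner, `x → 0` = uniform spanning two-forests, is Wilson's algorithm; memo bschramm/FROM-fk-1-g13-TWO-CLUSTER.md §4.)
[cite: KorteVygen2018, Lemma 2.1(c) (§2.1); Ch. 8, Exercise 1] [cite: Grimmett2006, Thm. (2.16) (FKG on a distributive lattice), §3.9 (pp. 63–65)]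
-/

namespace Summit.CriticalPhenomena.PercolationContinuityZ3.Theorems

namespace FK

namespace MinCut

open Finset
open scoped FinsetFamily

variable {V : Type*} [Fintype V] [DecidableEq V] (G : SimpleGraph V) [DecidableRel G.Adj]

/-- **Edge-boundary size** `|∂S|`: the number of ordered adjacent pairs `(x, y)` with `x ∈ S`, `y ∉ S` (each boundary edge counted once).
[cite: KorteVygen2018, §2.1 (δ(X))] -/
def cutSize (S : Finset V) : ℕ := ∑ x, ∑ y, if G.Adj x y ∧ x ∈ S ∧ y ∉ S then 1 else 0

/-- **Submodularity of the edge boundary**: `|∂(S ∪ T)| + |∂(S ∩ T)| ≤ |∂S| + |∂T|` (Korte–Vygen Lemma 2.1(c):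
the difference is `2|E(S∖T, T∖S)| ≥ 0`). [cite: KorteVygen2018, Lemma 2.1(c) (§2.1)] -/
theorem cutSize_union_add_inter_le (S T : Finset V) :
    cutSize G (S ∪ T) + cutSize G (S ∩ T) ≤ cutSize G S + cutSize G T := by
  unfold cutSize
  rw [← Finset.sum_add_distrib, ← Finset.sum_add_distrib]
  refine Finset.sum_le_sum fun x _ => ?_
  rw [← Finset.sum_add_distrib, ← Finset.sum_add_distrib]
  refine Finset.sum_le_sum fun y _ => ?_
  by_cases hA : G.Adj x y
  · simp only [hA, true_and, Finset.mem_union, Finset.mem_inter, not_or, not_and_or]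
    by_cases h1 : x ∈ S <;> by_cases h2 : x ∈ T <;> by_cases h3 : y ∈ S <;> by_cases h4 : y ∈ T <;> simp [h1, h2, h3, h4]
  · simp [hA]

/-- **Minimum `a–c` cut**: `a ∈ S`, `c ∉ S`, and `|∂S|` is least among all such vertex sets. [cite: KorteVygen2018, Ch. 8 (minimum s–t cuts)] -/
def IsMinCut (a c : V) (S : Finset V) : Prop :=
  a ∈ S ∧ c ∉ S ∧ ∀ T : Finset V, a ∈ T → c ∉ T → cutSize G S ≤ cutSize G T

/-- **Minimum cuts are closed under union.** [cite: KorteVygen2018, Ch. 8, Exercise 1] -/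
theorem isMinCut_union {a c : V} {S T : Finset V} (hS : IsMinCut G a c S) (hT : IsMinCut G a c T) : IsMinCut G a c (S ∪ T) := by
  obtain ⟨haS, hcS, hmS⟩ := hS
  obtain ⟨haT, hcT, hmT⟩ := hT
  have ha : a ∈ S ∪ T := Finset.mem_union_left _ haS
  have hc : c ∉ S ∪ T := by simp [hcS, hcT]
  have ha' : a ∈ S ∩ T := Finset.mem_inter.2 ⟨haS, haT⟩
  have hc' : c ∉ S ∩ T := by simp [hcS]
  have h1 := hmS _ ha hc      -- |∂S| ≤ |∂(S∪T)|
  have h2 := hmT _ ha' hc'    -- |∂T| ≤ |∂(S∩T)|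
  have hsub := cutSize_union_add_inter_le G S T
  refine ⟨ha, hc, fun U haU hcU => ?_⟩
  have := hmS U haU hcU
  omega

/-- **Minimum cuts are closed under intersection.** [cite: KorteVygen2018, Ch. 8, Exercise 1] -/
theorem isMinCut_inter {a c : V} {S T : Finset V} (hS : IsMinCut G a c S) (hT : IsMinCut G a c T) : IsMinCut G a c (S ∩ T) := by
  obtain ⟨haS, hcS, hmS⟩ := hS
  obtain ⟨haT, hcT, hmT⟩ := hT
  have ha : a ∈ S ∪ T := Finset.mem_union_left _ haS
  have hc : c ∉ S ∪ T := by simp [hcS, hcT]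
  have ha' : a ∈ S ∩ T := Finset.mem_inter.2 ⟨haS, haT⟩
  have hc' : c ∉ S ∩ T := by simp [hcS]
  have h1 := hmS _ ha hc
  have h2 := hmT _ ha' hc'
  have hsub := cutSize_union_add_inter_le G S T
  refine ⟨ha', hc', fun U haU hcU => ?_⟩
  have := hmT U haU hcU
  omega

open scoped Classical in
/-- The finite family of minimum `a–c` cuts. [cite: KorteVygen2018, Ch. 8 (minimum s–t cuts)] -/
noncomputable def minCuts (a c : V) : Finset (Finset V) := Finset.univ.filter fun S => IsMinCut G a c S

open scoped Classical in
/-- Membership in `minCuts`. [folklore] -/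
theorem mem_minCuts {a c : V} {S : Finset V} : S ∈ minCuts G a c ↔ IsMinCut G a c S := by
  simp [minCuts]

open scoped Classical in
/-- **The uniform measure on minimum `a–c` cuts is positively associated** (the `x → ∞` corner of `TwoClusterAssocPos`): for up-sets
`𝒰, 𝒱` of vertex sets, `#{S ∈ minCuts : S ∈ 𝒰} · #{S ∈ minCuts : S ∈ 𝒱} ≤ #{S ∈ minCuts : S ∈ 𝒰 ∩ 𝒱} · #minCuts`.
Proof: Daykin's inequality on the distributive lattice `Finset V` applied to the two sub-families, whose pairwise unions are min cuts in
`𝒰 ∩ 𝒱` and whose pairwise intersections are min cuts. [cite: KorteVygen2018, Ch. 8, Exercise 1] [cite: Grimmett2006, Thm. (2.16)] -/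
theorem minCuts_posAssoc (a c : V) (𝒰 𝒱 : Set (Finset V)) (h𝒰 : IsUpperSet 𝒰) (h𝒱 : IsUpperSet 𝒱) :
    #((minCuts G a c).filter (· ∈ 𝒰)) * #((minCuts G a c).filter (· ∈ 𝒱)) ≤
      #((minCuts G a c).filter fun S => S ∈ 𝒰 ∧ S ∈ 𝒱) * #(minCuts G a c) := by
  set s := (minCuts G a c).filter (· ∈ 𝒰) with hs
  set t := (minCuts G a c).filter (· ∈ 𝒱) with ht
  have hD := Finset.le_card_infs_mul_card_sups s t
  -- `s ⊻ t ⊆ min cuts in 𝒰 ∩ 𝒱`, `s ⊼ t ⊆ min cuts`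
  have hsup : s ⊻ t ⊆ (minCuts G a c).filter fun S => S ∈ 𝒰 ∧ S ∈ 𝒱 := by
    intro U hU
    rw [Finset.mem_sups] at hU
    obtain ⟨S, hS, T, hT, rfl⟩ := hU
    rw [hs, Finset.mem_filter, mem_minCuts] at hS
    rw [ht, Finset.mem_filter, mem_minCuts] at hT
    rw [Finset.mem_filter, mem_minCuts]
    refine ⟨?_, h𝒰 (Finset.subset_union_left : S ≤ S ⊔ T) hS.2, h𝒱 (Finset.subset_union_right : T ≤ S ⊔ T) hT.2⟩
    exact isMinCut_union G hS.1 hT.1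
  have hinf : s ⊼ t ⊆ minCuts G a c := by
    intro U hU
    rw [Finset.mem_infs] at hU
    obtain ⟨S, hS, T, hT, rfl⟩ := hU
    rw [hs, Finset.mem_filter, mem_minCuts] at hS
    rw [ht, Finset.mem_filter, mem_minCuts] at hT
    rw [mem_minCuts]
    exact isMinCut_inter G hS.1 hT.1
  calc #s * #t ≤ #(s ⊼ t) * #(s ⊻ t) := hD
    _ ≤ #(minCuts G a c) * #((minCuts G a c).filter fun S => S ∈ 𝒰 ∧ S ∈ 𝒱) :=
        Nat.mul_le_mul (Finset.card_le_card hinf) (Finset.card_le_card hsup)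
    _ = _ := Nat.mul_comm _ _

end MinCut

end FK

end Summit.CriticalPhenomena.PercolationContinuityZ3.Theorems
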